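import Literature.AlgebraicGeometry.Resolution.CohenMacaulayUnmixed
import Mathlib.RingTheory.Ideal.Colon
import HarnessLib

/-!
# Principality of a saturated ideal from a comparison isomorphism (SGA 2 XI 3.13, last step)

Topic `Literature/RingTheory/RegularLocalRing`. Elementary lemmas on `𝔪`-saturated ideals of a
Noetherian local ring `(B, 𝔪)` of depth `≥ 2`, isolating the last step of the algebraisation
argument for Grothendieck's parafactoriality theorem for hypersurfaces (the complete case `hC` of
`Grothendieck1968_samuelConjecture_hypersurface`, file `GrothendieckSamuelHypersurfaceComplete`):
once the module of formal sections has been algebraised, one is left with an `𝔪`-saturated ideal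
`J ∋` a non-zero-divisor, a subideal `D ⊆ J` with `𝔪^k J ⊆ D`, an `𝔪`-primary ideal `I` and a
`B`-linear isomorphism `D ≃ I`; then `J` is principal (`isPrincipal_of_linearEquiv_of_saturated`).
The mechanism ("`d₀ · I = p · D` for non-zero-divisors `d₀, p`, then saturate") is the
ideal-theoretic shadow of SGA 2 XI 3.5/3.9: an invertible sheaf on the punctured spectrum with an
`𝔪`-saturated module of sections is trivial as soon as it is isomorphic to the structure sheaf
off the closed point.

* `mem_of_forall_mem_pow_mul_mem` — iterating `𝔪`-saturation: `𝔪^k b ⊆ N ⇒ b ∈ N`.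
* `mem_span_singleton_of_forall_mul_mem` — **principal ideals generated by a non-zero-divisor
  are `𝔪`-saturated when `B` has a regular sequence of length `≥ 2` in `𝔪`** (depth `≥ 2`;
  via the tree's cutting-down lemma `exists_isRegular_quotSMulTop`, Rees).
* `isPrincipal_of_linearEquiv_of_saturated` — the statement above.

Everything is proved; no named facts.

## References

* [Grothendieck1968SGA2] A. Grothendieck, SGA 2, Exp. XI, Prop. 3.5, Cor. 3.9, Thm. 3.13 (ii)
  (arXiv:math/0511279, pp. 70–72).
* [Matsumura1987] H. Matsumura, *Commutative Ring Theory*, Thm. 16.7 (Rees), §17.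
-/

noncomputable section

universe u

namespace Literature.RingTheory.RegularLocalRing

open IsLocalRing RingTheory.Sequence nonZeroDivisors
open scoped Pointwise

variable {B : Type u} [CommRing B] [IsLocalRing B]

/-- **Iterated saturation.** If the ideal `N` is `𝔪`-saturated (`𝔪 b ⊆ N ⇒ b ∈ N`), then
`𝔪^k b ⊆ N ⇒ b ∈ N` for every `k`. [folklore] -/
theorem mem_of_forall_mem_pow_mul_mem (N : Ideal B)
    (hsat : ∀ b : B, (∀ x ∈ maximalIdeal B, x * b ∈ N) → b ∈ N) (k : ℕ) (b : B)
    (hb : ∀ z ∈ maximalIdeal B ^ k, z * b ∈ N) : b ∈ N := by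
  induction k generalizing b with
  | zero => simpa using hb 1 (by simp)
  | succ k ih =>
    exact ih b fun w hw => hsat _ fun x hx => by
      rw [← mul_assoc]
      exact hb _ (by rw [pow_succ']; exact Ideal.mul_mem_mul hx hw)

/-- A non-zero-divisor in `𝔪` makes the zero ideal `𝔪`-saturated: `𝔪 b = 0 ⇒ b = 0`. [folklore] -/
theorem eq_zero_of_forall_mul_eq_zero {x : B} (hxm : x ∈ maximalIdeal B) (hx : x ∈ B⁰) (b : B)
    (hb : ∀ z ∈ maximalIdeal B, z * b = 0) : b = 0 :=
  (mul_left_mem_nonZeroDivisors_eq_zero_iff hx).mp (hb x hxm)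

/-- **Principal ideals of a non-zero-divisor are `𝔪`-saturated in depth `≥ 2`.** If the
Noetherian local ring `B` has a `B`-regular sequence in `𝔪` of length `≥ 2` and `p` is a
non-zero-divisor, then `𝔪 b ⊆ (p) ⇒ b ∈ (p)`: for `p ∈ 𝔪`, the `B`-module `B/pB` still carries a
regular element `x ∈ 𝔪` (cutting down, Rees), and `x b ∈ (p)` forces `b ∈ (p)`.
[cite: Matsumura1987, Thm. 16.7 and Thm. 17.4] -/
theorem mem_span_singleton_of_forall_mul_mem [IsNoetherianRing B] {rs : List B}
    (hrs : IsRegular B rs) (hmem : ∀ r ∈ rs, r ∈ maximalIdeal B) (hlen : 2 ≤ rs.length) {p : B}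
    (hp : p ∈ B⁰) (b : B) (hb : ∀ x ∈ maximalIdeal B, x * b ∈ Ideal.span {p}) :
    b ∈ Ideal.span {p} := by
  by_cases hpu : IsUnit p
  · rw [Ideal.span_singleton_eq_top.mpr hpu]; exact Submodule.mem_top
  have hpm : p ∈ maximalIdeal B := (IsLocalRing.mem_maximalIdeal p).mpr hpu
  have hpreg : IsSMulRegular B p := IsSMulRegular.of_right_eq_zero_of_smul fun a ha =>
    (mul_left_mem_nonZeroDivisors_eq_zero_iff hp).mp ha
  obtain ⟨rs', hlen', hmem', hreg'⟩ :=
    Literature.AlgebraicGeometry.Resolution.exists_isRegular_quotSMulTop hrs hmem hpreg hpm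
  obtain ⟨x, rs'', rfl⟩ : ∃ x rs'', rs' = x :: rs'' := by
    match rs', hlen' with
    | [], h => simp at h; omega
    | (x :: l), _ => exact ⟨x, l, rfl⟩
  have hx : IsSMulRegular (QuotSMulTop p B) x := ((isWeaklyRegular_cons_iff _ x rs'').mp
    hreg'.toIsWeaklyRegular).1
  have hxm : x ∈ maximalIdeal B := hmem' x (by simp)
  -- `x • [b] = [x b] = 0` in `B/pB`
  have hxb : x * b ∈ (p • ⊤ : Submodule B B) := by
    obtain ⟨c, hc⟩ := Ideal.mem_span_singleton'.mp (hb x hxm)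
    exact (Submodule.mem_smul_pointwise_iff_exists _ _ _).mpr ⟨c, Submodule.mem_top, by
      rw [← hc, smul_eq_mul, mul_comm]⟩
  have h0 : x • (Submodule.Quotient.mk b : QuotSMulTop p B) = 0 := by
    rw [← Submodule.Quotient.mk_smul, smul_eq_mul]
    exact (Submodule.Quotient.mk_eq_zero _).mpr hxb
  have hb0 : (Submodule.Quotient.mk b : QuotSMulTop p B) = 0 := hx.right_eq_zero_of_smul h0
  obtain ⟨c, -, hc⟩ := (Submodule.mem_smul_pointwise_iff_exists _ _ _).mp
    ((Submodule.Quotient.mk_eq_zero _).mp hb0)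
  exact Ideal.mem_span_singleton'.mpr ⟨c, by rw [← hc, smul_eq_mul, mul_comm]⟩

/-- A regular sequence of positive length in `𝔪` provides a non-zero-divisor in `𝔪`. [folklore] -/
theorem exists_mem_maximalIdeal_mem_nonZeroDivisors_of_isRegular {rs : List B}
    (hrs : IsRegular B rs) (hmem : ∀ r ∈ rs, r ∈ maximalIdeal B) (hlen : 1 ≤ rs.length) :
    ∃ x ∈ maximalIdeal B, x ∈ B⁰ := by
  obtain ⟨x, rs', rfl⟩ : ∃ x rs', rs = x :: rs' := by
    match rs, hlen with
    | [], h => simp at h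
    | (x :: l), _ => exact ⟨x, l, rfl⟩
  have hx : IsSMulRegular B x := ((isWeaklyRegular_cons_iff _ x rs').mp hrs.toIsWeaklyRegular).1
  refine ⟨x, hmem x (by simp), mem_nonZeroDivisors_iff_right.mpr fun a ha => ?_⟩
  exact hx.right_eq_zero_of_smul (show x • a = 0 by rw [smul_eq_mul, mul_comm]; exact ha)

/-- **Principality of a saturated ideal from a comparison isomorphism** (the last step of the
algebraisation argument for SGA 2 XI 3.13 (ii), hypersurface case). Let `(B, 𝔪)` be a local ring
in which `𝔪` contains a non-zero-divisor and every principal ideal generated by a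
non-zero-divisor is `𝔪`-saturated (both hold in depth `≥ 2`). Let `J` be an `𝔪`-saturated
ideal containing a non-zero-divisor, `D ⊆ J` an ideal with `𝔪^k J ⊆ D`, `I` an ideal with
`𝔪^{k'} ⊆ I`, and `e : D ≃ I` a `B`-linear isomorphism. Then `J` is principal. Proof: for a
non-zero-divisor `d₀ ∈ D` and `p := e d₀` one has `d₀ · e(d) = p · d` (`e` is linear), `p` is a
non-zero-divisor, `d₀ = p j₀` with `j₀ ∈ J` (saturate `𝔪^{k'} d₀ ⊆ pD ⊆ (p)`, cancel `p`,
saturate in `J`), and `p j ∈ (d₀)` for every `j ∈ J` (saturate `𝔪^k (p j) ⊆ (d₀)`), whence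
`J = (j₀)`. [cite: Grothendieck1968SGA2, Exp. XI Prop. 3.5, Cor. 3.9, Thm. 3.13 (ii)] -/
theorem isPrincipal_of_linearEquiv_of_saturated
    (hx : ∃ x ∈ maximalIdeal B, x ∈ B⁰)
    (hsatp : ∀ p ∈ B⁰, ∀ b : B, (∀ x ∈ maximalIdeal B, x * b ∈ Ideal.span {p}) →
      b ∈ Ideal.span {p})
    (J : Ideal B) (hJsat : ∀ b : B, (∀ x ∈ maximalIdeal B, x * b ∈ J) → b ∈ J)
    (hc : ∃ c ∈ J, c ∈ B⁰) (D : Ideal B) (hDJ : D ≤ J) (k : ℕ)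
    (hk : maximalIdeal B ^ k * J ≤ D) (I : Ideal B) (k' : ℕ) (hk' : maximalIdeal B ^ k' ≤ I)
    (e : D ≃ₗ[B] I) : J.IsPrincipal := by
  obtain ⟨x, hxm, hx0⟩ := hx
  obtain ⟨c, hcJ, hc0⟩ := hc
  -- a non-zero-divisor `d₀ ∈ D`
  set d₀ : B := x ^ k * c with hd₀
  have hd₀D : d₀ ∈ D := hk (Ideal.mul_mem_mul (Ideal.pow_mem_pow hxm k) hcJ)
  have hd₀0 : d₀ ∈ B⁰ := mul_mem (pow_mem hx0 k) hc0
  set p : B := (e ⟨d₀, hd₀D⟩ : B) with hp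
  -- the key identity `d₀ · e(d) = p · d`
  have key : ∀ (d : B) (hd : d ∈ D), d₀ * (e ⟨d, hd⟩ : B) = p * d := by
    intro d hd
    have h1 : (d₀ • (⟨d, hd⟩ : D) : D) = d • (⟨d₀, hd₀D⟩ : D) := by
      apply Subtype.ext
      change d₀ • d = d • d₀
      rw [smul_eq_mul, smul_eq_mul, mul_comm]
    have h2 := congrArg (fun z : I => (z : B)) (congrArg e h1)
    simp only [map_smul, SetLike.val_smul, smul_eq_mul] at h2
    rw [h2, hp, mul_comm]
  -- every element of `I` is `e` of something
  have hsurj : ∀ i ∈ I, ∃ (d : B) (hd : d ∈ D), (e ⟨d, hd⟩ : B) = i := fun i hi => by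
    obtain ⟨⟨d, hd⟩, hd'⟩ := e.surjective ⟨i, hi⟩
    exact ⟨d, hd, by rw [hd']⟩
  -- `p` is a non-zero-divisor
  have hp0 : p ∈ B⁰ := by
    refine mem_nonZeroDivisors_iff_right.mpr fun b hb => ?_
    -- `I b = 0`
    have hIb : ∀ i ∈ I, i * b = 0 := by
      intro i hi
      obtain ⟨d, hd, rfl⟩ := hsurj i hi
      have h1 : d₀ * ((e ⟨d, hd⟩ : B) * b) = 0 := by
        rw [← mul_assoc, key d hd, mul_assoc, mul_comm d b, ← mul_assoc, mul_comm p b, hb,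
          zero_mul]
      exact (mul_left_mem_nonZeroDivisors_eq_zero_iff hd₀0).mp h1
    -- hence `𝔪^{k'} b = 0`, so `b = 0`
    refine mem_of_forall_mem_pow_mul_mem (⊥ : Ideal B) (fun b' hb' => ?_) k' b fun z hz => ?_
    · exact (Submodule.mem_bot B).mpr
        (eq_zero_of_forall_mul_eq_zero hxm hx0 b' fun z hz => (Submodule.mem_bot B).mp (hb' z hz))
    · exact (Submodule.mem_bot B).mpr (hIb z (hk' hz))
  -- `d₀ = p j₀` with `j₀ ∈ J`
  have hd₀p : d₀ ∈ Ideal.span {p} := by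
    refine mem_of_forall_mem_pow_mul_mem _ (hsatp p hp0) k' d₀ fun z hz => ?_
    obtain ⟨d, hd, hzd⟩ := hsurj z (hk' hz)
    rw [mul_comm, ← hzd, key d hd]
    exact Ideal.mul_mem_right d _ (Ideal.mem_span_singleton_self p)
  obtain ⟨j₀, hj₀⟩ := Ideal.mem_span_singleton'.mp hd₀p
  -- hj₀ : j₀ * p = d₀
  have hj₀J : j₀ ∈ J := by
    refine mem_of_forall_mem_pow_mul_mem J hJsat k' j₀ fun z hz => ?_
    obtain ⟨d, hd, hzd⟩ := hsurj z (hk' hz)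
    -- `p (z j₀) = z d₀ = d₀ e(d) = p d`
    have h1 : p * (z * j₀) = p * d := by
      rw [← key d hd, hzd, mul_comm d₀ z, ← hj₀]; ring
    rw [(mul_cancel_left_mem_nonZeroDivisors hp0).mp h1]
    exact hDJ hd
  -- every `j ∈ J` is a multiple of `j₀`
  have hJle : J ≤ Ideal.span {j₀} := by
    intro j hj
    have hpj : p * j ∈ Ideal.span {d₀} := by
      refine mem_of_forall_mem_pow_mul_mem _ (hsatp d₀ hd₀0) k (p * j) fun w hw => ?_
      have hwj : w * j ∈ D := hk (Ideal.mul_mem_mul hw hj)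
      rw [mul_left_comm, ← key (w * j) hwj]
      exact Ideal.mul_mem_right _ _ (Ideal.mem_span_singleton_self d₀)
    obtain ⟨b, hb⟩ := Ideal.mem_span_singleton'.mp hpj
    -- hb : b * d₀ = p * j, and d₀ = j₀ p, so p (b j₀) = p j
    have h1 : p * (b * j₀) = p * j := by rw [← hb, ← hj₀]; ring
    rw [← (mul_cancel_left_mem_nonZeroDivisors hp0).mp h1]
    exact Ideal.mul_mem_left _ b (Ideal.mem_span_singleton_self j₀)
  refine ⟨j₀, le_antisymm hJle ?_⟩
  rw [Ideal.submodule_span_eq, Ideal.span_singleton_le_iff_mem]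
  exact hj₀J

end Literature.RingTheory.RegularLocalRing

end
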